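import Literature.NumberTheory.BostConnes.FiniteLevels
import HarnessLib

/-!
# Bost–Connes system with a character observable: the twisted partition function at finite level

[CornelissenMarcolli2010] §3 realises `L`-series as values of the low-temperature KMS states of
the Bost–Connes-type system `(A_K, σ_K)` of a number field `K`: in the representation `π_γ` on
`ℓ²(J_K^+)` the time evolution is implemented by the Hamiltonian
`H_{σ_K} ε_𝔫 = log N(𝔫) ε_𝔫` (§3.2, eq. (9)), one has
`tr(π_γ(f) e^{-β H_{σ_K}}) = ∑_{𝔫 ∈ J_K^+} f(𝔫 ∗ γ) N(𝔫)^{-β}` (§3.3), the partition function is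
`ζ_K(β) = tr(e^{-β H_{σ_K}})` (§3.3, "convergent for `β > 1`"), and for a character `χ` of
`G_K^{ab}` the test function `f_χ` of eqs. (6)–(7) has the KMS value
`ω_{β,γ}(f_χ) = L_K(χ, β) / (ζ_K(β) χ(γ))` (§3.1, eq. (8)).

For `K = ℚ` and `γ = 1` this is the original Bost–Connes system on `ℓ²(ℕ^×)` with the *diagonal
character observable* `π(f_χ) ε_n = χ(n) ε_n` (`χ` a Dirichlet character, extended by `0` on
integers not coprime to its modulus — exactly Mathlib's `DirichletCharacter`, a multiplicative
character of `ZMod N` vanishing on non-units), and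
`tr(π(f_χ) e^{-sH}) = ∑_n χ(n) n^{-s} = L(χ, s)`.

As in `Literature.NumberTheory.BostConnes.FiniteLevels` (Laca's integer-lattice systems
[Laca1998] §4.1: restrict the semigroup `ℕ^×` to `N_S^× = {n : p ∣ n ⇒ p ∈ S}` for a **finite** set
`S` of primes, `β_c = 0`), this file records the exact finite-level datum, fully proved:

* `hasSum_twistedPartitionFunction`: for finite `S`, any Dirichlet character `χ` and every
  `s ∈ ℂ` with `0 < Re s`, the twisted partition function converges absolutely and
  `∑_{n ∈ N_S^×} χ(n) n^{-s} = ∏_{p ∈ S} (1 - χ(p) p^{-s})⁻¹`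
  (the `S`-truncated Euler product of `L(χ, s)`; for `S` = all primes and `Re s > 1` this is
  Mathlib's `DirichletCharacter.LSeries_eulerProduct_tprod`).
* `kmsValue_character_eq_prod`: the finite-level shadow of eq. (8) (`γ = 1`): the normalised
  value `(∑_{n ∈ N_S^×} χ(n) n^{-s}) / (∑_{n ∈ N_S^×} n^{-s})` equals
  `∏_{p ∈ S} (1 - p^{-s}) / (1 - χ(p) p^{-s})`, i.e. `L_S(χ,s)/ζ_S(s)` with both Euler products
  truncated to `S`.

What is NOT here: the `C⋆`-dynamical system `(A_K, σ_K)` itself, the KMS classification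
([LLN] Thm. 2.1 quoted in §3.1), number fields `K ≠ ℚ` (Mathlib has no Dedekind-zeta Euler
product over ideals in the needed form), and the anabelian reconstruction theorems of the paper.
No definitions and no named facts are introduced.

## Sources (read at the page)

* [CornelissenMarcolli2010] G. Cornelissen, M. Marcolli, *Quantum Statistical Mechanics,
  `L`-series and Anabelian Geometry*, arXiv:1009.0736: §3.1 eqs. (5)–(8), §3.2 eq. (9), §3.3
  (held text `paper:arxiv-1009.0736`, chunk p0012).
* [Laca1998] M. Laca, J. Funct. Anal. 152 (1998) 330–378, §4.1 pp. 347–348 (finite `S`: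
  `β_c = 0`), as used in `FiniteLevels`.
* [ConnesMarcolli2008] A. Connes, M. Marcolli, *Noncommutative Geometry, Quantum Fields and
  Motives*, Ch. 3 (3.141)–(3.142) (`H ε_n = log(n) ε_n`, `Z(β) = ζ(β)`).
-/

noncomputable section

open Finset Complex

namespace Literature.NumberTheory.BostConnes

/-! ## The character-twisted partition function of the `S`-restricted system -/

/-- For a prime `p` and `Re s > 0`: `‖p^{-s}‖ < 1`. [folklore] -/
private theorem norm_natCast_cpow_neg_lt_one_of_prime {p : ℕ} (hp : p.Prime) {s : ℂ}
    (hs : 0 < s.re) : ‖(p : ℂ) ^ (-s)‖ < 1 := by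
  rw [Complex.norm_natCast_cpow_of_pos hp.pos, Complex.neg_re]
  exact Real.rpow_lt_one_of_one_lt_of_neg (by exact_mod_cast hp.one_lt) (by linarith)

/-- For a prime `p`, a Dirichlet character `χ` and `Re s > 0`: `‖χ(p) p^{-s}‖ < 1`, so the
Euler factor `(1 - χ(p) p^{-s})⁻¹ = ∑_e χ(p)^e p^{-es}` is a convergent geometric series.
[folklore] -/
private theorem norm_character_mul_cpow_neg_lt_one {N : ℕ} (χ : DirichletCharacter ℂ N) {p : ℕ}
    (hp : p.Prime) {s : ℂ} (hs : 0 < s.re) :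
    ‖χ (p : ZMod N) * (p : ℂ) ^ (-s)‖ < 1 := by
  rw [norm_mul]
  have h1 : ‖χ (p : ZMod N)‖ ≤ 1 := χ.norm_le_one _
  have h2 : ‖(p : ℂ) ^ (-s)‖ < 1 := norm_natCast_cpow_neg_lt_one_of_prime hp hs
  calc ‖χ (p : ZMod N)‖ * ‖(p : ℂ) ^ (-s)‖ ≤ 1 * ‖(p : ℂ) ^ (-s)‖ := by gcongr
    _ < 1 := by rwa [one_mul]

/-- **Twisted partition function of the `S`-restricted Bost–Connes system with a character
observable.** For a *finite* set `S` of primes, a Dirichlet character `χ` (of any modulus `N`,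
extended by `0` to non-units of `ℤ/Nℤ`) and every `s ∈ ℂ` with `0 < Re s`, the series
`tr(π(f_χ) e^{-sH}) = ∑_{n ∈ N_S^×} χ(n) n^{-s}` over the positive integers all of whose prime
factors lie in `S` converges absolutely and equals the `S`-truncated Euler product
`∏_{p ∈ S} (1 - χ(p) p^{-s})⁻¹`. This is the `K = ℚ`, `γ = 1`, `S`-restricted case of
[CornelissenMarcolli2010] §3.3 (`tr(π_γ(f) e^{-βH}) = ∑_𝔫 f(𝔫 ∗ γ) N(𝔫)^{-β}`) for the test
function `f_χ` of eqs. (6)–(7) (`f_χ(𝔫 ∗ 1) = χ(𝔫)`), with Laca's `β_c = 0` for finite `S`; for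
`S` = all primes and `Re s > 1` it is the Euler product of `L(χ, s)` (Mathlib
`DirichletCharacter.LSeries_eulerProduct_tprod`).
[cite: CornelissenMarcolli2010, §3.1 eqs. (6)–(8), §3.2 eq. (9), §3.3] -/
theorem summable_and_hasSum_twistedPartitionFunction {S : Finset ℕ} (hS : ∀ p ∈ S, p.Prime)
    {N : ℕ} (χ : DirichletCharacter ℂ N) {s : ℂ} (hs : 0 < s.re) :
    Summable (fun m : Nat.factoredNumbers S =>
        ‖χ ((m : ℕ) : ZMod N) * ((m : ℕ) : ℂ) ^ (-s)‖) ∧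
      HasSum (fun m : Nat.factoredNumbers S => χ ((m : ℕ) : ZMod N) * ((m : ℕ) : ℂ) ^ (-s))
        (∏ p ∈ S, (1 - χ (p : ZMod N) * (p : ℂ) ^ (-s))⁻¹) := by
  have hs0 : s ≠ 0 := by
    rintro rfl
    simp at hs
  have h := EulerProduct.summable_and_hasSum_factoredNumbers_prod_filter_prime_geometric
    (f := (dirichletSummandHom χ hs0 : ℕ →* ℂ)) (fun {p} hp => ?_) S
  · have hfilter : S.filter Nat.Prime = S := Finset.filter_true_of_mem hS
    rw [hfilter] at h
    simpa [dirichletSummandHom] using h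
  · simpa [dirichletSummandHom] using norm_character_mul_cpow_neg_lt_one χ hp hs

/-- The twisted partition function identity in `HasSum` form:
`∑_{n ∈ N_S^×} χ(n) n^{-s} = ∏_{p ∈ S} (1 - χ(p) p^{-s})⁻¹` for finite `S` and `Re s > 0`.
[cite: CornelissenMarcolli2010, §3.1 eq. (8), §3.3] -/
theorem hasSum_twistedPartitionFunction {S : Finset ℕ} (hS : ∀ p ∈ S, p.Prime) {N : ℕ}
    (χ : DirichletCharacter ℂ N) {s : ℂ} (hs : 0 < s.re) :
    HasSum (fun m : Nat.factoredNumbers S => χ ((m : ℕ) : ZMod N) * ((m : ℕ) : ℂ) ^ (-s))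
      (∏ p ∈ S, (1 - χ (p : ZMod N) * (p : ℂ) ^ (-s))⁻¹) :=
  (summable_and_hasSum_twistedPartitionFunction hS χ hs).2

/-- `π(f_χ) e^{-sH}` is trace class on `ℓ²(N_S^×)` for `Re s > 0` when `S` is finite: the
eigenvalue series `∑_{n ∈ N_S^×} |χ(n) n^{-s}|` converges.
[cite: CornelissenMarcolli2010, §3.3] -/
theorem summable_norm_twistedPartitionFunction {S : Finset ℕ} (hS : ∀ p ∈ S, p.Prime) {N : ℕ}
    (χ : DirichletCharacter ℂ N) {s : ℂ} (hs : 0 < s.re) :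
    Summable (fun m : Nat.factoredNumbers S =>
      ‖χ ((m : ℕ) : ZMod N) * ((m : ℕ) : ℂ) ^ (-s)‖) :=
  (summable_and_hasSum_twistedPartitionFunction hS χ hs).1

/-- The twisted partition function as a value:
`∑'_{n ∈ N_S^×} χ(n) n^{-s} = ∏_{p ∈ S} (1 - χ(p) p^{-s})⁻¹` (`S` finite, `Re s > 0`).
[cite: CornelissenMarcolli2010, §3.1 eq. (8), §3.3] -/
theorem twistedPartitionFunction_eq_eulerProduct {S : Finset ℕ} (hS : ∀ p ∈ S, p.Prime)
    {N : ℕ} (χ : DirichletCharacter ℂ N) {s : ℂ} (hs : 0 < s.re) :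
    ∑' m : Nat.factoredNumbers S, χ ((m : ℕ) : ZMod N) * ((m : ℕ) : ℂ) ^ (-s) =
      ∏ p ∈ S, (1 - χ (p : ZMod N) * (p : ℂ) ^ (-s))⁻¹ :=
  (hasSum_twistedPartitionFunction hS χ hs).tsum_eq

/-- **The finite-level KMS value of the character observable** (the `S`-truncated shadow of
[CornelissenMarcolli2010] eq. (8), `ω_{β,1}(f_χ) = L(χ,β)/ζ(β)`): for finite `S` and `Re s > 0`,
`(∑_{n ∈ N_S^×} χ(n) n^{-s}) / (∑_{n ∈ N_S^×} n^{-s}) = ∏_{p ∈ S} (1 - p^{-s}) / (1 - χ(p) p^{-s})`,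
the ratio of the two `S`-truncated Euler products (the denominator is the partition function of
`Literature.NumberTheory.BostConnes.partitionFunction_eq_eulerProduct`).
[cite: CornelissenMarcolli2010, §3.1 eqs. (5), (8)] -/
theorem kmsValue_character_eq_prod {S : Finset ℕ} (hS : ∀ p ∈ S, p.Prime) {N : ℕ}
    (χ : DirichletCharacter ℂ N) {s : ℂ} (hs : 0 < s.re) :
    (∑' m : Nat.factoredNumbers S, χ ((m : ℕ) : ZMod N) * ((m : ℕ) : ℂ) ^ (-s)) /
        (∑' m : Nat.factoredNumbers S, ((m : ℕ) : ℂ) ^ (-s)) =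
      ∏ p ∈ S, (1 - (p : ℂ) ^ (-s)) / (1 - χ (p : ZMod N) * (p : ℂ) ^ (-s)) := by
  rw [twistedPartitionFunction_eq_eulerProduct hS χ hs, partitionFunction_eq_eulerProduct hS hs,
    ← Finset.prod_div_distrib]
  refine Finset.prod_congr rfl fun p hp => ?_
  rw [inv_div_inv]

end Literature.NumberTheory.BostConnes

end
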